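import Mathlib
import Summits.ResolutionOfSingularities.ResolutionOfSingularities.Theorems.WildQuotientsWildQuotientResolutionToricExitConeDefs

/-!
# V3U-C3: the cone presentation has range `k[coneGens]` and kernel `(y_P y_R − y_Q²)`

(crux stmt-ResolutionOfSingularities-15640 `WildQuotients.WildQuotientResolution`, line `Sketch`,
sector `|G| = p`; programme V3U of `L/w45c/CHAIN.md` v5, candidate C3 `conePresentation_range_ker` of
`L/w45c/W45cPlanSignaturesV5.lean` §C, signature VERBATIM (defs `ToricExit.coneGens` /
`ToricExit.conePresentation` of `…ToricExitConeDefs`). [OURS · L1 W4.5c] — NOT a statement of any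
manuscript; replaces the role of no printed item. Prover res-L1-w45c-stub-4.)

Proof. (i) `algebraicIndependent_of_isIntegral_X`: a family `x : Fin n → k[x₁,…,xₙ]` over whose
`k`-subalgebra every variable is integral is algebraically independent (transcendence degree:
Mathlib `Algebra.IsAlgebraic.isTranscendenceBasis_of_lift_le_trdeg_of_finite`). Applied to
`(ρ², N², c′, passengers)` (`x_a² = ρ²`, `(x_b^p − ρ^{p−1}x_b)² = N²` with `ρ^{p−1} = (ρ²)^{(p−1)/2}`,
`x_c = c′ + (x_b² − ρ x_b)/2`) it makes `Ψ = aeval (ρ², N², c′, …)` injective. (ii) Single out `y_Q`: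
`k[y] ≅ (k[x])[Y]` (`renameEquiv (swap none (some b))` then `optionEquivLeft`); modulo the monic
`Y² − x_a x_b` every `F` is `(Y² − x_a x_b)·G + C r₁·Y + C r₀`, and under the cone presentation this
reads `0 = Ψ r₁ · ρN + Ψ r₀`. (iii) The `k`-algebra map `ι : x_b ↦ −x_b`, `x_c ↦ x_c + x_a x_b` fixes
`Ψ` and negates `ρN` (`p` odd, `2 ∈ kˣ`), so `Ψ r₀ = 0 = Ψ r₁ · ρN`, hence `r₀ = r₁ = 0` and
`F ∈ (y_P y_R − y_Q²)`. (iv) The range is `k[range of the generators] = k[coneGens]`.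
-/

-- single-problem summit: the doubled namespace component `ResolutionOfSingularities` is forced
set_option linter.dupNamespace false

noncomputable section

open MvPolynomial

namespace Summit.ResolutionOfSingularities.ResolutionOfSingularities.Theorems.WildQuotientResolution.ToricExit

/-! ## Generic helpers -/

/-- **`n` elements of `k[x₁,…,xₙ]` over which every variable is integral are algebraically
independent** (transcendence degree `n`). [folklore] -/
theorem algebraicIndependent_of_isIntegral_X (k : Type) [Field k] (n : ℕ)
    (x : Fin n → MvPolynomial (Fin n) k)
    (hint : ∀ i, IsIntegral (Algebra.adjoin k (Set.range x)) (X i : MvPolynomial (Fin n) k)) :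
    AlgebraicIndependent k x := by
  let S := Algebra.adjoin k (Set.range x)
  haveI : Algebra.IsIntegral S (MvPolynomial (Fin n) k) := by
    refine ⟨fun f => ?_⟩
    induction f using MvPolynomial.induction_on with
    | C r =>
      rw [← MvPolynomial.algebraMap_eq, IsScalarTower.algebraMap_apply k S (MvPolynomial (Fin n) k)]
      exact isIntegral_algebraMap
    | add p q hp hq => exact hp.add hq
    | mul_X p i hp => exact hp.mul (hint i)
  haveI : Algebra.IsAlgebraic S (MvPolynomial (Fin n) k) := inferInstance
  exact (Algebra.IsAlgebraic.isTranscendenceBasis_of_lift_le_trdeg_of_finite k x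
    (MvPolynomial.algebraicIndependent_X (Fin n) k).lift_cardinalMk_le_trdeg).1

/-- `X^m − s X` is monic of degree `m` for `m ≥ 2`. [folklore] -/
theorem monic_X_pow_sub_C_mul_X {R : Type} [CommRing R] [Nontrivial R] (m : ℕ) (hm : 2 ≤ m)
    (s : R) :
    (Polynomial.X ^ m - Polynomial.C s * Polynomial.X : Polynomial R).Monic ∧
      (Polynomial.X ^ m - Polynomial.C s * Polynomial.X : Polynomial R).natDegree = m := by
  have hlt : (Polynomial.C s * Polynomial.X : Polynomial R).natDegree <
      (Polynomial.X ^ m : Polynomial R).natDegree := by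
    rw [Polynomial.natDegree_X_pow]
    exact lt_of_le_of_lt ((Polynomial.natDegree_C_mul_le s _).trans Polynomial.natDegree_X_le)
      (by omega)
  refine ⟨(Polynomial.monic_X_pow m).sub_of_left (Polynomial.degree_lt_degree hlt), ?_⟩
  rw [Polynomial.natDegree_sub_eq_left_of_natDegree_lt hlt, Polynomial.natDegree_X_pow]

/-- `(X^m − s X)² − t` is monic for `m ≥ 2`. [folklore] -/
theorem monic_sq_X_pow_sub_C_mul_X_sub_C {R : Type} [CommRing R] [Nontrivial R] (m : ℕ) (hm : 2 ≤ m)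
    (s t : R) :
    ((Polynomial.X ^ m - Polynomial.C s * Polynomial.X) ^ 2 - Polynomial.C t).Monic := by
  obtain ⟨h1, hnat⟩ := monic_X_pow_sub_C_mul_X m hm s
  refine (h1.pow 2).sub_of_left (lt_of_le_of_lt Polynomial.degree_C_le ?_)
  rw [Polynomial.degree_eq_natDegree (h1.pow 2).ne_zero, h1.natDegree_pow, hnat]
  exact_mod_cast (by omega : 0 < 2 * m)

section Psi

variable (p : ℕ) (hp : p.Prime) (hp3 : 3 ≤ p) (k : Type) [Field k] [CharP k p] (n : ℕ)
  (a b c : Fin n) (hab : a ≠ b) (hbc : b ≠ c) (hac : a ≠ c)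

include hp3 in
/-- `2 ≠ 0` in `k[x]` when `char k = p ≥ 3`. [folklore] -/
theorem two_ne_zero_mvPolynomial : (2 : MvPolynomial (Fin n) k) ≠ 0 := by
  intro h
  have h2 : ((2 : ℕ) : MvPolynomial (Fin n) k) = 0 := by exact_mod_cast h
  rw [CharP.cast_eq_zero_iff (MvPolynomial (Fin n) k) p] at h2
  have := Nat.le_of_dvd two_pos h2
  omega

include hp hp3 in
/-- `p − 1 = 2 · ((p − 1)/2)` for an odd prime. [folklore] -/
theorem two_mul_half_pred : 2 * ((p - 1) / 2) = p - 1 := by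
  have hodd : Odd p := hp.odd_of_ne_two (by omega)
  obtain ⟨m, hm⟩ := hodd
  omega

omit [CharP k p] in
include hp hp3 hab hbc hac in
/-- **`Ψ = aeval (ρ², N², c′, passengers)` is injective** (`x_a`, `x_b`, `x_c` are integral over
`k[ρ², N², c′, passengers]`). [folklore] -/
theorem aeval_psi_injective :
    Function.Injective (MvPolynomial.aeval (R := k) (fun i : Fin n =>
      if i = a then (X a ^ 2 : MvPolynomial (Fin n) k)
      else if i = b then (X b ^ p - X a ^ (p - 1) * X b) ^ 2
      else if i = c then X c - C (2⁻¹ : k) * (X b ^ 2 - X a * X b) else X i)) := by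
  classical
  set x : Fin n → MvPolynomial (Fin n) k := fun i =>
      if i = a then (X a ^ 2 : MvPolynomial (Fin n) k)
      else if i = b then (X b ^ p - X a ^ (p - 1) * X b) ^ 2
      else if i = c then X c - C (2⁻¹ : k) * (X b ^ 2 - X a * X b) else X i with hx
  have hba : b ≠ a := fun h => hab h.symm
  have hca : c ≠ a := fun h => hac h.symm
  have hcb : c ≠ b := fun h => hbc h.symm
  have hxa : x a = X a ^ 2 := by simp [x]
  have hxb : x b = (X b ^ p - X a ^ (p - 1) * X b) ^ 2 := by simp [x, hba]
  have hxc : x c = X c - C (2⁻¹ : k) * (X b ^ 2 - X a * X b) := by simp [x, hca, hcb]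
  have hxi : ∀ i, i ≠ a → i ≠ b → i ≠ c → x i = X i := fun i hia hib hic => by
    simp [x, hia, hib, hic]
  let S := Algebra.adjoin k (Set.range x)
  have hmem : ∀ i, x i ∈ S := fun i => Algebra.subset_adjoin ⟨i, rfl⟩
  have hSval : ∀ (s : S), algebraMap S (MvPolynomial (Fin n) k) s = (s : MvPolynomial (Fin n) k) :=
    fun s => rfl
  have hintS : ∀ (v : MvPolynomial (Fin n) k) (hv : v ∈ S), IsIntegral S v := fun v hv => by
    simpa using (isIntegral_algebraMap : IsIntegral S (algebraMap S (MvPolynomial (Fin n) k) ⟨v, hv⟩))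
  -- `x_a`: `T² − ρ²`
  have ha : IsIntegral S (X a : MvPolynomial (Fin n) k) := by
    refine IsIntegral.of_pow two_pos ?_
    rw [← hxa]
    exact hintS _ (hmem a)
  -- `x_b`: `(T^p − ρ^{p−1} T)² − N²`
  have hrho : (X a ^ (p - 1) : MvPolynomial (Fin n) k) ∈ S := by
    have h : (X a ^ 2) ^ ((p - 1) / 2) ∈ S := Subalgebra.pow_mem _ (hxa ▸ hmem a) _
    rwa [← pow_mul, two_mul_half_pred p hp hp3] at h
  have hb : IsIntegral S (X b : MvPolynomial (Fin n) k) := by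
    refine ⟨(Polynomial.X ^ p - Polynomial.C (⟨X a ^ (p - 1), hrho⟩ : S) * Polynomial.X) ^ 2 -
      Polynomial.C ⟨x b, hmem b⟩, monic_sq_X_pow_sub_C_mul_X_sub_C p (by omega) _ _, ?_⟩
    simp only [Polynomial.eval₂_sub, Polynomial.eval₂_pow, Polynomial.eval₂_mul, Polynomial.eval₂_X,
      Polynomial.eval₂_C, hSval, hxb]
    ring
  -- `x_c = c′ + (x_b² − ρ x_b)/2`
  have hc : IsIntegral S (X c : MvPolynomial (Fin n) k) := by
    have hc' : IsIntegral S (x c) := hintS _ (hmem c)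
    have h2 : IsIntegral S (C (2⁻¹ : k) : MvPolynomial (Fin n) k) := by
      rw [← MvPolynomial.algebraMap_eq, IsScalarTower.algebraMap_apply k S (MvPolynomial (Fin n) k)]
      exact isIntegral_algebraMap
    have e : (X c : MvPolynomial (Fin n) k) = x c + C (2⁻¹ : k) * (X b ^ 2 - X a * X b) := by
      rw [hxc]; ring
    rw [e]
    exact hc'.add (h2.mul ((hb.pow 2).sub (ha.mul hb)))
  refine (algebraicIndependent_of_isIntegral_X k n x fun i => ?_)
  by_cases hia : i = a
  · rw [hia]; exact ha
  by_cases hib : i = b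
  · rw [hib]; exact hb
  by_cases hic : i = c
  · rw [hic]; exact hc
  rw [← hxi i hia hib hic]
  exact hintS _ (hmem i)


omit [CharP k p] in
include hp3 hab in
/-- `N = x_b^p − ρ^{p−1} x_b ≠ 0` (evaluate at `x_b = 1`, `x_a = 0`). [folklore] -/
theorem norm_ne_zero : (X b ^ p - X a ^ (p - 1) * X b : MvPolynomial (Fin n) k) ≠ 0 := by
  classical
  intro h
  have h1 := congrArg (MvPolynomial.eval (fun i : Fin n => if i = b then (1 : k) else 0)) h
  have hab' : ¬ a = b := hab
  simp only [map_sub, map_pow, map_mul, MvPolynomial.eval_X, if_true, hab', if_false, one_pow,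
    mul_one, map_zero, zero_pow (by omega : p - 1 ≠ 0), sub_zero] at h1
  exact one_ne_zero h1

include hp hp3 hab hbc hac in
/-- **The kernel of the cone presentation is contained in `(y_P y_R − y_Q²)`** (normal form modulo the
monic `Y² − x_a x_b` after singling out `y_Q`, the sign-twist `x_b ↦ −x_b, x_c ↦ x_c + x_a x_b`, and
injectivity of `Ψ`). [folklore] -/
theorem ker_conePresentation_le :
    RingHom.ker (conePresentation k p n a b c) ≤
      Ideal.span {(X (some a) * X none - X (some b) ^ 2 : MvPolynomial (Option (Fin n)) k)} := by
  classical
  have hba : b ≠ a := fun h => hab h.symm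
  have hca : c ≠ a := fun h => hac h.symm
  have hcb : c ≠ b := fun h => hbc h.symm
  -- abbreviations
  let Φ : MvPolynomial (Option (Fin n)) k →ₐ[k] MvPolynomial (Fin n) k := conePresentation k p n a b c
  let N : MvPolynomial (Fin n) k := X b ^ p - X a ^ (p - 1) * X b
  have hΦa : Φ (X (some a)) = X a ^ 2 := conePresentation_X_a k p n a b c
  have hΦb : Φ (X (some b)) = X a * N := conePresentation_X_b k p n a b c hab
  have hΦn : Φ (X none) = N ^ 2 := conePresentation_X_none k p n a b c
  have hΦc : Φ (X (some c)) = X c - C (2⁻¹ : k) * (X b ^ 2 - X a * X b) :=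
    conePresentation_X_c k p n a b c hac hbc
  have hΦi : ∀ i, i ≠ a → i ≠ b → i ≠ c → Φ (X (some i)) = X i :=
    fun i hia hib hic => conePresentation_X_of_ne k p n a b c i hia hib hic
  -- `Ψ = aeval (ρ², N², c′, passengers)`
  let ψf : Fin n → MvPolynomial (Fin n) k := fun i =>
    if i = a then (X a ^ 2 : MvPolynomial (Fin n) k) else if i = b then (X b ^ p - X a ^ (p - 1) * X b) ^ 2
    else if i = c then X c - C (2⁻¹ : k) * (X b ^ 2 - X a * X b) else X i
  let Ψ : MvPolynomial (Fin n) k →ₐ[k] MvPolynomial (Fin n) k := aeval ψf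
  have hΨa : Ψ (X a) = X a ^ 2 := by simp [Ψ, ψf]
  have hΨb : Ψ (X b) = N ^ 2 := by simp [Ψ, ψf, hba, N]
  have hΨc : Ψ (X c) = X c - C (2⁻¹ : k) * (X b ^ 2 - X a * X b) := by simp [Ψ, ψf, hca, hcb]
  have hΨi : ∀ i, i ≠ a → i ≠ b → i ≠ c → Ψ (X i) = X i := fun i hia hib hic => by
    simp [Ψ, ψf, hia, hib, hic]
  have hΨinj : Function.Injective Ψ := aeval_psi_injective p hp hp3 k n a b c hab hbc hac
  -- single out `y_Q`: `E : k[y] ≃ A[Y]`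
  let sw : Equiv.Perm (Option (Fin n)) := Equiv.swap none (some b)
  let E : MvPolynomial (Option (Fin n)) k ≃ₐ[k] Polynomial (MvPolynomial (Fin n) k) :=
    (renameEquiv k sw).trans (optionEquivLeft k (Fin n))
  have hEb : E (X (some b)) = Polynomial.X := by
    simp [E, sw, Equiv.swap_apply_right]
  have hEn : E (X none) = Polynomial.C (X b) := by
    simp [E, sw, Equiv.swap_apply_left]
  have hEi : ∀ i, i ≠ b → E (X (some i)) = Polynomial.C (X i) := by
    intro i hib
    have hsw : sw (some i) = some i :=
      Equiv.swap_apply_of_ne_of_ne (Option.some_ne_none i) (fun h => hib (Option.some_injective _ h))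
    simp [E, hsw]
  -- `Φ' = Φ ∘ E⁻¹` on `A[Y]`: constants go through `Ψ`, `Y` goes to `ρ N`
  let Φ' : Polynomial (MvPolynomial (Fin n) k) →ₐ[k] MvPolynomial (Fin n) k :=
    Φ.comp (E.symm : Polynomial (MvPolynomial (Fin n) k) →ₐ[k] MvPolynomial (Option (Fin n)) k)
  have hΦ'X : Φ' Polynomial.X = X a * N := by
    change Φ (E.symm Polynomial.X) = _
    rw [← hEb, AlgEquiv.symm_apply_apply, hΦb]
  have hΦ'C : ∀ q : MvPolynomial (Fin n) k, Φ' (Polynomial.C q) = Ψ q := by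
    intro q
    have h : Φ'.comp (IsScalarTower.toAlgHom k (MvPolynomial (Fin n) k)
        (Polynomial (MvPolynomial (Fin n) k))) = Ψ := by
      refine MvPolynomial.algHom_ext fun i => ?_
      change Φ (E.symm (Polynomial.C (X i))) = Ψ (X i)
      by_cases hib : i = b
      · rw [hib, ← hEn, AlgEquiv.symm_apply_apply, hΦn, hΨb]
      · rw [← hEi i hib, AlgEquiv.symm_apply_apply]
        by_cases hia : i = a
        · rw [hia, hΦa, hΨa]
        · by_cases hic : i = c
          · rw [hic, hΦc, hΨc]
          · rw [hΦi i hia hib hic, hΨi i hia hib hic]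
    exact AlgHom.congr_fun h q
  -- the sign twist `ι`
  let ιf : Fin n → MvPolynomial (Fin n) k := fun i => if i = b then -X b else if i = c then X c + X a * X b else X i
  let ι : MvPolynomial (Fin n) k →ₐ[k] MvPolynomial (Fin n) k := aeval ιf
  have hιa : ι (X a) = X a := by simp [ι, ιf, hab, hac]
  have hιb : ι (X b) = -X b := by simp [ι, ιf]
  have hιc : ι (X c) = X c + X a * X b := by simp [ι, ιf, hcb]
  have hιi : ∀ i, i ≠ b → i ≠ c → ι (X i) = X i := fun i hib hic => by simp [ι, ιf, hib, hic]
  have hodd : Odd p := hp.odd_of_ne_two (by omega)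
  have h2k : (2 : k) ≠ 0 := fun h => by
    have h' : ((2 : ℕ) : k) = 0 := by exact_mod_cast h
    rw [CharP.cast_eq_zero_iff k p] at h'
    have := Nat.le_of_dvd two_pos h'
    omega
  have h2 : (C (2⁻¹ : k) : MvPolynomial (Fin n) k) * 2 = 1 := by
    rw [← map_ofNat (C : k →+* MvPolynomial (Fin n) k) 2, ← map_mul, inv_mul_cancel₀ h2k, map_one]
  have hιN : ι N = -N := by
    simp only [N, map_sub, map_mul, map_pow, hιa, hιb, hodd.neg_pow]
    ring
  have hιΨ : ∀ q : MvPolynomial (Fin n) k, ι (Ψ q) = Ψ q := by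
    intro q
    have h : ι.comp Ψ = Ψ := by
      refine MvPolynomial.algHom_ext fun i => ?_
      rw [AlgHom.comp_apply]
      by_cases hia : i = a
      · rw [hia, hΨa, map_pow, hιa]
      · by_cases hib : i = b
        · rw [hib, hΨb, map_pow, hιN, neg_sq]
        · by_cases hic : i = c
          · rw [hic, hΨc, map_sub, map_mul, MvPolynomial.algHom_C, map_sub, map_pow, map_mul, hιc, hιa,
              hιb]
            simp only [MvPolynomial.algebraMap_eq]
            linear_combination (-(X a * X b)) * h2
          · rw [hΨi i hia hib hic, hιi i hib hic]
    exact AlgHom.congr_fun h q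
  -- the normal form of `E F` modulo `g = Y² − x_a x_b`
  intro F hF
  rw [RingHom.mem_ker] at hF
  let g : Polynomial (MvPolynomial (Fin n) k) := Polynomial.X ^ 2 - Polynomial.C (X a * X b)
  have hg : g.Monic := Polynomial.monic_X_pow_sub_C _ two_ne_zero
  have hgdeg : g.natDegree = 2 := Polynomial.natDegree_X_pow_sub_C
  have hg1 : g ≠ 1 := fun h => by
    have h' := congrArg Polynomial.natDegree h
    rw [hgdeg, Polynomial.natDegree_one] at h'
    exact two_ne_zero h'
  set F' := E F with hF'
  set r := F' %ₘ g with hr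
  have hrdeg : r.natDegree ≤ 1 := by
    have h := Polynomial.natDegree_modByMonic_lt F' hg hg1
    rw [hgdeg] at h
    change r.natDegree < 2 at h
    omega
  have hreq : r = Polynomial.C (r.coeff 1) * Polynomial.X + Polynomial.C (r.coeff 0) :=
    Polynomial.eq_X_add_C_of_natDegree_le_one hrdeg
  have hdecomp : r + g * (F' /ₘ g) = F' := Polynomial.modByMonic_add_div F' g
  -- apply `Φ'`
  have hΦ'F : Φ' F' = 0 := by
    rw [hF']
    change Φ (E.symm (E F)) = 0
    rw [AlgEquiv.symm_apply_apply]
    exact hF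
  have hΦ'g : Φ' g = 0 := by
    simp only [g, map_sub, map_pow, hΦ'X, hΦ'C, map_mul, hΨa, hΨb]
    ring
  have key : Ψ (r.coeff 1) * (X a * N) + Ψ (r.coeff 0) = 0 := by
    have h : Φ' (r + g * (F' /ₘ g)) = 0 := by rw [hdecomp]; exact hΦ'F
    rw [map_add, map_mul, hΦ'g, zero_mul, add_zero, hreq, map_add, map_mul, hΦ'C, hΦ'X, hΦ'C] at h
    exact h
  have key' : -(Ψ (r.coeff 1) * (X a * N)) + Ψ (r.coeff 0) = 0 := by
    have h := congrArg ι key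
    rw [map_add, map_mul, map_mul, hιΨ, hιa, hιN, hιΨ, map_zero] at h
    linear_combination h
  have h0 : Ψ (r.coeff 0) = 0 := by
    have h : (2 : MvPolynomial (Fin n) k) * Ψ (r.coeff 0) = 0 := by linear_combination key + key'
    exact (mul_eq_zero.1 h).resolve_left (two_ne_zero_mvPolynomial p hp3 k n)
  have h1 : Ψ (r.coeff 1) = 0 := by
    have h : Ψ (r.coeff 1) * (X a * N) = 0 := by linear_combination key - h0
    exact (mul_eq_zero.1 h).resolve_right
      (mul_ne_zero (X_ne_zero a) (norm_ne_zero p hp3 k n a b hab))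
  have hr0 : r.coeff 0 = 0 := hΨinj (by rw [map_zero]; exact h0)
  have hr1 : r.coeff 1 = 0 := hΨinj (by rw [map_zero]; exact h1)
  have hrz : r = 0 := by rw [hreq, hr0, hr1, map_zero, zero_mul, zero_add]
  -- back to `k[y]`: `F = (E⁻¹ g) · (E⁻¹ q)` and `E⁻¹ g = −(y_P y_R − y_Q²)`
  have hEf : E (X (some a) * X none - X (some b) ^ 2) = -g := by
    rw [map_sub, map_mul, map_pow, hEi a hab, hEn, hEb, ← map_mul]
    simp only [g]
    ring
  have hEg : E.symm g = -(X (some a) * X none - X (some b) ^ 2) := by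
    rw [AlgEquiv.symm_apply_eq, map_neg, hEf, neg_neg]
  have hF2 : F = E.symm g * E.symm (F' /ₘ g) := by
    have h : F' = g * (F' /ₘ g) := by
      have h' := hdecomp
      rw [hrz, zero_add] at h'
      exact h'.symm
    calc F = E.symm F' := by rw [hF', AlgEquiv.symm_apply_apply]
      _ = E.symm (g * (F' /ₘ g)) := by rw [← h]
      _ = E.symm g * E.symm (F' /ₘ g) := map_mul _ _ _
  rw [hF2, hEg, Ideal.mem_span_singleton]
  exact ⟨-E.symm (F' /ₘ g), by ring⟩

omit [CharP k p] in
include hab hbc hac in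
/-- **The range of the cone presentation is `k[coneGens]`** (range of `aeval` = `adjoin` of the range
of the generator assignment, which is the set `coneGens`). [folklore] -/
theorem range_conePresentation :
    (conePresentation k p n a b c).range = Algebra.adjoin k (coneGens k p n a b c) := by
  have hba : b ≠ a := fun h => hab h.symm
  have hca : c ≠ a := fun h => hac h.symm
  have hcb : c ≠ b := fun h => hbc h.symm
  rw [conePresentation, ← Algebra.adjoin_range_eq_range_aeval]
  congr 1
  ext y
  simp only [coneGens, Set.mem_range, Set.mem_union, Set.mem_insert_iff, Set.mem_singleton_iff,
    Set.mem_image, Set.mem_setOf_eq]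
  constructor
  · rintro ⟨o, rfl⟩
    rcases o with _ | i
    · exact Or.inl (Or.inr (Or.inr (Or.inl rfl)))
    · by_cases hia : i = a
      · subst hia
        exact Or.inl (Or.inl (by simp))
      · by_cases hib : i = b
        · subst hib
          exact Or.inl (Or.inr (Or.inl (by simp [hia])))
        · by_cases hic : i = c
          · subst hic
            exact Or.inl (Or.inr (Or.inr (Or.inr (by simp [hia, hib]))))
          · exact Or.inr ⟨i, ⟨hia, hib, hic⟩, by simp [hia, hib, hic]⟩
  · rintro (h | ⟨i, ⟨hia, hib, hic⟩, rfl⟩)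
    · rcases h with rfl | rfl | rfl | rfl
      · exact ⟨some a, by simp⟩
      · exact ⟨some b, by simp [hba]⟩
      · exact ⟨none, rfl⟩
      · exact ⟨some c, by simp [hca, hcb]⟩
    · exact ⟨some i, by simp [hia, hib, hic]⟩

end Psi

/-- **V3U-C3 `conePresentation_range_ker`** (`W45cPlanSignaturesV5.lean` §C, verbatim): the cone
presentation `k[y_P, y_Q, y_R, y_c, passengers] → k[x]` is onto `k[coneGens]` with kernel exactly
`(y_P y_R − y_Q²)` — the `σ`-invariants of chart a of the toric exit form the `A₁`-cone `× 𝔸ⁿ⁻²`.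
[OURS · L1 W4.5c] -/
theorem conePresentation_range_ker (p : ℕ) (hp : p.Prime) (hp3 : 3 ≤ p) (k : Type) [Field k]
    [CharP k p] (n : ℕ) (a b c : Fin n) (hab : a ≠ b) (hbc : b ≠ c) (hac : a ≠ c) :
    (conePresentation k p n a b c).range = Algebra.adjoin k (coneGens k p n a b c) ∧
      RingHom.ker (conePresentation k p n a b c) =
        Ideal.span {X (some a) * X none - X (some b) ^ 2} := by
  refine ⟨range_conePresentation p k n a b c hab hbc hac, le_antisymm
    (ker_conePresentation_le p hp hp3 k n a b c hab hbc hac) ?_⟩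
  rw [Ideal.span_le, Set.singleton_subset_iff, SetLike.mem_coe, RingHom.mem_ker]
  rw [map_sub, map_mul, map_pow, conePresentation_X_a, conePresentation_X_none,
    conePresentation_X_b k p n a b c hab]
  ring


end Summit.ResolutionOfSingularities.ResolutionOfSingularities.Theorems.WildQuotientResolution.ToricExit

end
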